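import Mathlib
import Summits.KontsevichZagierPeriods.Zeta5Search.FloorLawBounds
import HarnessLib

/-!
# ζ(5) search — class/block counts and gen-2 g7's floor facts (F1), (F2)

Cell `pub-zeta5` (HONEST FRAMING: systematic search; no irrationality claim unless certified), typer seat
generation 8.  Combinatorial groundwork for the `V`-floor mechanism of gen-2 g8 (REPORT-gen2-g8 §2; REPORT-gen2-g7 §1):
for a residue class `x (mod p)` among the positions `0..b₀` and the block `B_j = [b_j, b₀ − b_j]` of the `j`-th lower
parameter, `nB j = #(class ∩ B_j)`.  Contents:

* `classExp_ge_card_sub`: `E_x ≥ #class − Σ_j nB j` (the centre terms are non-negative; `Σ_{s ∈ class} depth(s) = Σ_j nB j`);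
* `card_mul_le_span`: `p·(#S − 1) ≤ max S − min S` for a set of positions in one residue class (distinct class points differ by
  multiples of `p`);
* **(F1)** `floorFact1`: `(nB i − 1) + (nB k − 1) ≤ 2⌊(b₀ − b_i − b_k)/p⌋` for two met blocks;
* **(F2)** `floorFact2`: `nB k − 1 ≤ ⌊(b₀ − b_i − b_k)/p⌋` for a met block `B_k ⊆ B_i` (`b_i ≤ b_k`);
* stars of the pair floors: `Σ_{k ≠ i₀} N_{i₀k} + Σ_{k ∉ {i₀,i₁}} N_{i₁k} ≤ N_p`.
Integer bookkeeping; nothing about irrationality.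
-/

noncomputable section

open Finset

namespace Summit.KontsevichZagierPeriods.Zeta5Search.ClusterValuation

open Summit.KontsevichZagierPeriods.Zeta5Search.DualSeries (InBox)
open Summit.KontsevichZagierPeriods.Zeta5Search.CasoratianValuation (InPolytope pairFloors)
open Summit.KontsevichZagierPeriods.Zeta5Search.BigPrime (block)

/-! ### Class/block counts -/

/-- The block of the `j`-th lower parameter: `[b_{j+1}, b₀ − b_{j+1}]`. -/
def blk (b : ℕ → ℤ) (j : ℕ) : Finset ℕ := block (b 0).toNat (b (j + 1)).toNat

/-- `nB j = #(class(x) ∩ B_j)`. -/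
def nB (b : ℕ → ℤ) (p x j : ℕ) : ℕ := ((classSet b p x).filter fun s => s ∈ blk b j).card

/-- `blockCount` is the number of blocks containing the position. -/
theorem blockCount_eq (b : ℕ → ℤ) (s : ℕ) : blockCount b s = ((range 7).filter fun j => s ∈ blk b j).card := rfl

/-- `Σ_{s ∈ class} depth(s) = Σ_j nB j` (double counting). -/
theorem sum_blockCount_eq (b : ℕ → ℤ) (p x : ℕ) :
    ∑ s ∈ classSet b p x, (blockCount b s : ℤ) = ∑ j ∈ range 7, (nB b p x j : ℤ) := by
  simp only [blockCount_eq, nB, card_filter, Nat.cast_sum, Nat.cast_ite, Nat.cast_one, Nat.cast_zero]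
  exact sum_comm

/-- **`E_x ≥ #class − Σ_j nB j`.** -/
theorem classExp_ge_card_sub (b : ℕ → ℤ) (p x : ℕ) :
    ((classSet b p x).card : ℤ) - ∑ j ∈ range 7, (nB b p x j : ℤ) ≤ classExp b p x := by
  unfold classExp
  rw [← sum_blockCount_eq]
  have h1 : ∑ s ∈ classSet b p x, netExp b s ≥ ∑ s ∈ classSet b p x, (1 - (blockCount b s : ℤ)) := by
    refine sum_le_sum fun s _ => ?_
    unfold netExp; split_ifs <;> omega
  have h2 : ∑ s ∈ classSet b p x, (1 - (blockCount b s : ℤ)) =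
      ((classSet b p x).card : ℤ) - ∑ s ∈ classSet b p x, (blockCount b s : ℤ) := by
    rw [sum_sub_distrib, sum_const, nsmul_eq_mul, mul_one]
  have h3 : (0 : ℤ) ≤ (if ¬ (2 : ℤ) ∣ b 0 ∧ CentreIn b p x then 1 else 0) := by split_ifs <;> norm_num
  linarith

/-! ### Positions in one residue class -/

/-- Two positions of one class differ by a multiple of `p`. -/
theorem dvd_sub_of_mem_classSet (b : ℕ → ℤ) {p x u v : ℕ} (hu : u ∈ classSet b p x) (hv : v ∈ classSet b p x) :
    (p : ℤ) ∣ (u : ℤ) - v := by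
  have hu' : u % p = x % p := (mem_filter.1 hu).2
  have hv' : v % p = x % p := (mem_filter.1 hv).2
  rw [dvd_sub_comm]
  exact Nat.modEq_iff_dvd.1 (hu'.trans hv'.symm)

/-- **Span bound**: a set `S` of positions in one residue class satisfies `p·(#S − 1) ≤ max S − min S`. -/
theorem card_mul_le_span (b : ℕ → ℤ) {p x : ℕ} (hp : 0 < p) (S : Finset ℕ) (hS : S ⊆ classSet b p x) (hne : S.Nonempty) :
    (p : ℤ) * ((S.card : ℤ) - 1) ≤ (S.max' hne : ℤ) - (S.min' hne : ℤ) := by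
  -- `s ↦ s / p` is injective on `S` and lands in `[min/p, max/p]`
  have hres : ∀ s ∈ S, s % p = x % p := fun s hs => (mem_filter.1 (hS hs)).2
  have hinj : Set.InjOn (fun s => s / p) (S : Set ℕ) := by
    intro s hs t ht hst
    have es := (Nat.div_add_mod s p).symm
    have et := (Nat.div_add_mod t p).symm
    have hms := hres s hs
    have hmt := hres t ht
    simp only at hst
    rw [hst, hms] at es
    rw [hmt] at et
    omega
  have hmaps : Set.MapsTo (fun s => s / p) (S : Set ℕ) (Icc (S.min' hne / p) (S.max' hne / p) : Finset ℕ) := by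
    intro s hs
    simp only [coe_Icc, Set.mem_Icc]
    exact ⟨Nat.div_le_div_right (S.min'_le s hs), Nat.div_le_div_right (S.le_max' s hs)⟩
  have hcard := card_le_card_of_injOn _ hmaps hinj
  rw [Nat.card_Icc] at hcard
  -- `max − min = p·(max/p − min/p)` (same residue)
  have hmin := hres _ (S.min'_mem hne)
  have hmax := hres _ (S.max'_mem hne)
  have hdm := Nat.div_add_mod (S.min' hne) p
  have hdM := Nat.div_add_mod (S.max' hne) p
  have hle : S.min' hne / p ≤ S.max' hne / p := Nat.div_le_div_right (S.min'_le _ (S.max'_mem hne))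
  have hcard' : (S.card : ℤ) - 1 ≤ (S.max' hne / p : ℕ) - (S.min' hne / p : ℕ) := by omega
  calc (p : ℤ) * ((S.card : ℤ) - 1) ≤ (p : ℤ) * ((S.max' hne / p : ℕ) - (S.min' hne / p : ℕ) : ℤ) :=
        mul_le_mul_of_nonneg_left hcard' (by positivity)
    _ = (S.max' hne : ℤ) - (S.min' hne : ℤ) := by push_cast; nlinarith [hdm, hdM, hmin, hmax]

/-! ### The floor facts (F1), (F2) -/

/-- Membership in a block, unfolded. -/
theorem mem_blk (b : ℕ → ℤ) (j s : ℕ) : s ∈ blk b j ↔ (b (j + 1)).toNat ≤ s ∧ s ≤ (b 0).toNat - (b (j + 1)).toNat := by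
  simp [blk, block]

/-- **(F1)**: `(nB i − 1) + (nB k − 1) ≤ 2·⌊(b₀ − b_i − b_k)/p⌋` for two met blocks. -/
theorem floorFact1 (b : ℕ → ℤ) (hb : InPolytope b) {p x : ℕ} (hp : 0 < p) {i k : ℕ} (hi : i < 7) (hk : k < 7)
    (hmi : 1 ≤ nB b p x i) (hmk : 1 ≤ nB b p x k) :
    ((nB b p x i : ℤ) - 1) + ((nB b p x k : ℤ) - 1) ≤ 2 * pairTerm b p i k := by
  set Si := (classSet b p x).filter fun s => s ∈ blk b i with hSi
  set Sk := (classSet b p x).filter fun s => s ∈ blk b k with hSk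
  have hnei : Si.Nonempty := card_pos.1 (by rw [hSi]; exact hmi)
  have hnek : Sk.Nonempty := card_pos.1 (by rw [hSk]; exact hmk)
  have hsubi : Si ⊆ classSet b p x := filter_subset _ _
  have hsubk : Sk ⊆ classSet b p x := filter_subset _ _
  have h1 := card_mul_le_span b hp Si hsubi hnei
  have h2 := card_mul_le_span b hp Sk hsubk hnek
  -- the cross differences are multiples of `p` below `b₀ − b_i − b_k`
  have hβi : 0 ≤ b (i + 1) := (hb.1.2 i (mem_range.2 hi)).1
  have hβk : 0 ≤ b (k + 1) := (hb.1.2 k (mem_range.2 hk)).1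
  have h0 : 0 ≤ b 0 := hb.1.1
  have hMi := (mem_blk b i _).1 (mem_filter.1 (Si.max'_mem hnei)).2
  have hmi' := (mem_blk b i _).1 (mem_filter.1 (Si.min'_mem hnei)).2
  have hMk := (mem_blk b k _).1 (mem_filter.1 (Sk.max'_mem hnek)).2
  have hmk' := (mem_blk b k _).1 (mem_filter.1 (Sk.min'_mem hnek)).2
  have hd1 : (p : ℤ) ∣ (Si.max' hnei : ℤ) - (Sk.min' hnek : ℤ) :=
    dvd_sub_of_mem_classSet b (hsubi (Si.max'_mem hnei)) (hsubk (Sk.min'_mem hnek))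
  have hd2 : (p : ℤ) ∣ (Sk.max' hnek : ℤ) - (Si.min' hnei : ℤ) :=
    dvd_sub_of_mem_classSet b (hsubk (Sk.max'_mem hnek)) (hsubi (Si.min'_mem hnei))
  obtain ⟨m₁, hm₁⟩ := hd1
  obtain ⟨m₂, hm₂⟩ := hd2
  have hb1 : m₁ ≤ pairTerm b p i k := by
    refine Int.le_ediv_of_mul_le (by exact_mod_cast hp) ?_
    have : (Si.max' hnei : ℤ) - (Sk.min' hnek : ℤ) ≤ b 0 - b (i + 1) - b (k + 1) := by omega
    linarith [mul_comm (p : ℤ) m₁]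
  have hb2 : m₂ ≤ pairTerm b p i k := by
    refine Int.le_ediv_of_mul_le (by exact_mod_cast hp) ?_
    have : (Sk.max' hnek : ℤ) - (Si.min' hnei : ℤ) ≤ b 0 - b (i + 1) - b (k + 1) := by omega
    linarith [mul_comm (p : ℤ) m₂]
  -- combine
  have hsum : (p : ℤ) * (((nB b p x i : ℤ) - 1) + ((nB b p x k : ℤ) - 1)) ≤ (p : ℤ) * (m₁ + m₂) := by
    have e : ((Si.max' hnei : ℤ) - (Si.min' hnei : ℤ)) + ((Sk.max' hnek : ℤ) - (Sk.min' hnek : ℤ)) =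
        (p : ℤ) * m₁ + (p : ℤ) * m₂ := by rw [← hm₁, ← hm₂]; ring
    have : (p : ℤ) * (((Si.card : ℤ) - 1) + ((Sk.card : ℤ) - 1)) ≤ (p : ℤ) * m₁ + (p : ℤ) * m₂ := by
      rw [mul_add, ← e]; exact add_le_add h1 h2
    simpa [hSi, hSk, nB, mul_add] using this
  have := le_of_mul_le_mul_left hsum (by exact_mod_cast hp : (0 : ℤ) < p)
  linarith

/-- **(F2)**: `nB k − 1 ≤ ⌊(b₀ − b_i − b_k)/p⌋` for a met block `B_k` and any `b_i ≤ b_k`. -/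
theorem floorFact2 (b : ℕ → ℤ) (hb : InPolytope b) {p x : ℕ} (hp : 0 < p) {i k : ℕ} (hi : i < 7) (hk : k < 7)
    (hik : b (i + 1) ≤ b (k + 1)) (hmk : 1 ≤ nB b p x k) : (nB b p x k : ℤ) - 1 ≤ pairTerm b p i k := by
  set Sk := (classSet b p x).filter fun s => s ∈ blk b k with hSk
  have hnek : Sk.Nonempty := card_pos.1 (by rw [hSk]; exact hmk)
  have hsubk : Sk ⊆ classSet b p x := filter_subset _ _
  have h2 := card_mul_le_span b hp Sk hsubk hnek
  have hβi : 0 ≤ b (i + 1) := (hb.1.2 i (mem_range.2 hi)).1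
  have hβk : 0 ≤ b (k + 1) := (hb.1.2 k (mem_range.2 hk)).1
  have h0 : 0 ≤ b 0 := hb.1.1
  have hMk := (mem_blk b k _).1 (mem_filter.1 (Sk.max'_mem hnek)).2
  have hmk' := (mem_blk b k _).1 (mem_filter.1 (Sk.min'_mem hnek)).2
  obtain ⟨m, hm⟩ := dvd_sub_of_mem_classSet b (hsubk (Sk.max'_mem hnek)) (hsubk (Sk.min'_mem hnek))
  have hbm : m ≤ pairTerm b p i k := by
    refine Int.le_ediv_of_mul_le (by exact_mod_cast hp) ?_
    have : (Sk.max' hnek : ℤ) - (Sk.min' hnek : ℤ) ≤ b 0 - b (i + 1) - b (k + 1) := by omega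
    linarith [mul_comm (p : ℤ) m]
  have : (p : ℤ) * ((Sk.card : ℤ) - 1) ≤ (p : ℤ) * m := by rw [← hm]; exact h2
  have := le_of_mul_le_mul_left this (by exact_mod_cast hp : (0 : ℤ) < p)
  have hc : (nB b p x k : ℤ) = Sk.card := by rw [hSk, nB]
  linarith

/-! ### Stars of the pair floors -/

/-- The pair-floor sum restricted to an index set. -/
def pairSum (b : ℕ → ℤ) (p : ℕ) (S : Finset ℕ) : ℤ := ∑ i ∈ S, ∑ k ∈ S, if i < k then pairTerm b p i k else 0

/-- `pairSum` over all seven indices is `N_p`. -/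
theorem pairSum_range (b : ℕ → ℤ) (p : ℕ) : pairSum b p (range 7) = pairFloors b p := rfl

/-- `pairTerm` is symmetric. -/
theorem pairTerm_comm (b : ℕ → ℤ) (p i k : ℕ) : pairTerm b p i k = pairTerm b p k i := by
  unfold pairTerm; ring_nf

/-- **Star decomposition**: `pairSum S = Σ_{k ∈ S∖i₀} N_{i₀k} + pairSum (S∖i₀)` for `i₀ ∈ S`. -/
theorem pairSum_erase (b : ℕ → ℤ) (p : ℕ) {S : Finset ℕ} {i₀ : ℕ} (h : i₀ ∈ S) :
    pairSum b p S = (∑ k ∈ S.erase i₀, pairTerm b p i₀ k) + pairSum b p (S.erase i₀) := by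
  unfold pairSum
  rw [← add_sum_erase S _ h]
  have hrow : ∀ i ∈ S, ∑ k ∈ S, (if i < k then pairTerm b p i k else 0) =
      (if i < i₀ then pairTerm b p i i₀ else 0) + ∑ k ∈ S.erase i₀, (if i < k then pairTerm b p i k else 0) := by
    intro i _; rw [← add_sum_erase S _ h]
  rw [hrow i₀ h, if_neg (lt_irrefl _), zero_add, sum_congr rfl fun i hi => hrow i (mem_of_mem_erase hi), sum_add_distrib]
  -- Σ_{i ∈ S∖i₀} [i<i₀] N_{i i₀} + Σ_{k∈S∖i₀} [i₀<k] N_{i₀k} = Σ_{k ∈ S∖i₀} N_{i₀k}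
  have hstar : ∑ i ∈ S.erase i₀, (if i < i₀ then pairTerm b p i i₀ else 0) +
      ∑ k ∈ S.erase i₀, (if i₀ < k then pairTerm b p i₀ k else 0) = ∑ k ∈ S.erase i₀, pairTerm b p i₀ k := by
    rw [← sum_add_distrib]
    refine sum_congr rfl fun k hk => ?_
    have hne : k ≠ i₀ := (mem_erase.1 hk).1
    rcases lt_or_gt_of_ne hne with hlt | hgt
    · rw [if_pos hlt, if_neg (not_lt.2 hlt.le), add_zero, pairTerm_comm]
    · rw [if_neg (not_lt.2 hgt.le), if_pos hgt, zero_add]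
  linarith

/-- `pairSum` is non-negative on the polytope (indices `< 7`). -/
theorem pairSum_nonneg (b : ℕ → ℤ) (hb : InPolytope b) (p : ℕ) {S : Finset ℕ} (hS : S ⊆ range 7) :
    0 ≤ pairSum b p S := by
  unfold pairSum
  refine sum_nonneg fun i hi => sum_nonneg fun k hk => ?_
  split_ifs
  · exact pairTerm_nonneg b hb p (mem_range.1 (hS hi)) (mem_range.1 (hS hk))
  · exact le_rfl

/-- **Two stars fit under `N_p`**: for `i₀ ≠ i₁` in `range 7`,
`Σ_{k ≠ i₀} N_{i₀k} + Σ_{k ∉ {i₀,i₁}} N_{i₁k} ≤ N_p`. -/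
theorem two_stars_le_pairFloors (b : ℕ → ℤ) (hb : InPolytope b) (p : ℕ) {i₀ i₁ : ℕ} (hi₀ : i₀ < 7) (hi₁ : i₁ < 7)
    (hne : i₁ ≠ i₀) :
    (∑ k ∈ (range 7).erase i₀, pairTerm b p i₀ k) + ∑ k ∈ ((range 7).erase i₀).erase i₁, pairTerm b p i₁ k ≤
      pairFloors b p := by
  have h1 := pairSum_erase b p (mem_range.2 hi₀ : i₀ ∈ range 7)
  have h2 := pairSum_erase b p (mem_erase.2 ⟨hne, mem_range.2 hi₁⟩ : i₁ ∈ (range 7).erase i₀)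
  have h3 := pairSum_nonneg b hb p (S := ((range 7).erase i₀).erase i₁)
    ((erase_subset _ _).trans (erase_subset _ _))
  rw [← pairSum_range]
  linarith

end Summit.KontsevichZagierPeriods.Zeta5Search.ClusterValuation

end
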